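import Summits.CriticalPhenomena.PercolationContinuityZ3.Theorems.PercNearOneGluingNoHeavyQuantBandTwoBlobFlow
import Summits.CriticalPhenomena.PercolationContinuityZ3.Theorems.PercNearOneGluingNoHeavyQuantBandTwoBlobPoly
import HarnessLib

/-!
# QUANT lane R8, T-DEC: the BAND PIECE of SL-λ* — part 3: the giant inequality in the five cells of the corner strategy (denominators cleared
# onto the certificates) and the numerics of the strategy

builds on p205010 (kernel theorem, internal audit signed; external expert review pending)

Support file (`--supports stmt-CriticalPhenomena-4575`), QUANT lane typer seat prim-quant-stmt (gen 24), rung R8 of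
`run/shared/lean/prim/quant/LADDER.md`.  Theorems only (real variables), standard axioms, no sorries.  Parts 1–2: `…QuantBandTwoBlobFlow` (typed
statement `LawDec.BandTwoBlobDEC`, flow reduction `twoBlob_decAtT_of_bandFlow`), `…QuantBandTwoBlobPoly` (polynomial certificates
`BandTwoBlobCert.poly_C1/C2L/C2H/C3L/C3H`); part 4 `…QuantBandTwoBlobDEC` assembles `bandTwoBlobDEC_holds`.

With `κ = (γ − x²)/(1 − x)`, `γ = x² + (1−x)κ`, `T = bκ + ag`, masses `m₀ = (1−γ)(1−g)`, `m_b = γ(1−g)`, `m_a = (1−γ)g`, `m_s = γg`, closed usage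
rates `u₁` of the pair `(b, a)` (light form `(x²(a−b) + (1−x)(T−2b))/((1−x)((1−x)b + (1+x)a − T))` when `T − 2b ≤ x(a−b)`, heavy form
`(T−2b)/(b+a−T)` otherwise) and `u₂ = T/(a−T)` of the pair `(0, a)` (always heavy: `T/a ≥ g ≥ x`):
* `giant_C1`, `giant_C2L/H`, `giant_C3L/H` — the giant inequality of the corner strategy in each cell, from the certificates by clearing the
  positive denominators (`(m_s − LHS)·den = N ≥ 0`): C1 `a ≤ T` (atom `0` cannot use the mid): `x/(1−x)·m₀ ≤ m_s`; C2 `T < a`, atom `0` ships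
  `(m_a − u₁m_b)/u₂`: `x/(1−x)·(m₀ − (m_a − u₁m_b)/u₂) ≤ m_s`; C3 `b` saturates the mid: `x/(1−x)·(m_b − m_a/u₁ + m₀) ≤ m_s`;
* `band_numerics_L/H` — the corner strategy as numbers: `F₁ ∈ [0, m_b]`, `F₂ ∈ [0, m₀]` (`F₂ > 0 → T < a`) with `u₁F₁ + u₂F₂ ≤ m_a` and
  `x/(1−x)·((m_b − F₁) + (m₀ − F₂)) ≤ m_s` (`b` to capacity: `F₁ = min(m_b, m_a/u₁)`; then atom `0`: `F₂ = min(m₀, (m_a − u₁m_b)/u₂)`, or `0` when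
  `a ≤ T`).
Exact evidence before the proof: census-1 g19 SLAMSTAR-G19 §2 (grid 40 014 / 0, random 37 175 / 0, two engines 270 626 / 0), typer g24 second
implementation (explore/band_piece.py: 32 466 + 4 100 / 0, real size ratio).

[this work]; DEC rules ARCH-TREES-G49 §2.2 / DEC-TAMP-G50 §3.1, flow normal form `…QuantLawDecFlows` (this lane).  Nothing here is cited as a
published result.  The gluing rows served [cite: KozmaNitzan2024, Conjecture 3 (p. 15)]; product measure [cite: Grimmett1999, §1.3 p. 10].
-/

noncomputable section

namespace Summit.CriticalPhenomena.PercolationContinuityZ3.Theorems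

namespace Quant

open Finset

namespace LawDec

/-! ### The giant inequality in the five cells (real variables) -/

section Cells

variable (x κ g a b : ℝ)

set_option maxHeartbeats 4000000 in
set_option maxRecDepth 100000 in
/-- **cell C1** (`a ≤ T`: atom `0` cannot use the mid; `b` fits): `x/(1−x)·m₀ ≤ m_s`. [this work] -/
theorem giant_C1 (_hx0 : 0 < x) (hx1 : x < 1) (hk0 : 0 < κ) (hkx : κ < x) (hxg : x ≤ g) (hg1 : g ≤ 1) (hb0 : 0 < b)
    (hband : 2 * b ≤ b * κ + a * g) (hTa : a ≤ b * κ + a * g) :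
    x / (1 - x) * ((1 - (x ^ 2 + (1 - x) * κ)) * (1 - g)) ≤ (x ^ 2 + (1 - x) * κ) * g := by
  have h1x : 0 < 1 - x := sub_pos.2 hx1
  have key := BandTwoBlobCert.poly_C1 x κ g a b (by linarith) (by linarith) (by linarith) (by linarith) (by linarith) (by linarith) (by linarith) (by linarith) (by linarith)
  have e : ((x ^ 2 + (1 - x) * κ) * g - x / (1 - x) * ((1 - (x ^ 2 + (1 - x) * κ)) * (1 - g))) * (b * (1 - x))
      = -2 * x^3 * g * b + x^3 * b + 2 * x^2 * κ * g * b - x^2 * κ * b + x^2 * g * b - 3 * x * κ * g * b + x * κ * b + x * g * b - x * b + κ * g * b := by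
    field_simp
    ring
  have hD : 0 < b * (1 - x) := mul_pos hb0 h1x
  have h := (mul_nonneg_iff_of_pos_right hD).1 (by rw [e]; exact key)
  linarith

set_option maxHeartbeats 4000000 in
set_option maxRecDepth 100000 in
/-- **cell C2L** (`T < a`, pair `(b,a)` light; `b` fits, atom `0` ships `(m_a − u₁m_b)/u₂` to the mid):
`x/(1−x)·(m₀ − (m_a − u₁m_b)(a − T)/T) ≤ m_s`. [this work] -/
theorem giant_C2L (hx0 : 0 < x) (hx1 : x < 1) (hk0 : 0 < κ) (hkx : κ < x) (hxg : x ≤ g) (hg1 : g ≤ 1) (hb0 : 0 < b) (hab : b < a)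
    (hband : 2 * b ≤ b * κ + a * g) (hTa : b * κ + a * g < a) (hL : b * κ + a * g - 2 * b ≤ x * (a - b)) :
    x / (1 - x) * ((1 - (x ^ 2 + (1 - x) * κ)) * (1 - g)
      - ((1 - (x ^ 2 + (1 - x) * κ)) * g
          - (x ^ 2 * (a - b) + (1 - x) * (b * κ + a * g - 2 * b)) / ((1 - x) * ((1 - x) * b + (1 + x) * a - (b * κ + a * g)))
            * ((x ^ 2 + (1 - x) * κ) * (1 - g))) * (a - (b * κ + a * g)) / (b * κ + a * g))
      ≤ (x ^ 2 + (1 - x) * κ) * g := by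
  have h1x : 0 < 1 - x := sub_pos.2 hx1
  have ha0 : 0 < a := hb0.trans hab
  have hg0 : 0 < g := hx0.trans_le hxg
  have hgam : 0 < x ^ 2 + (1 - x) * κ := by nlinarith [mul_pos h1x hk0, pow_pos hx0 2]
  have hgam1 : x ^ 2 + (1 - x) * κ < 1 := by nlinarith [mul_lt_mul_of_pos_left hkx h1x]
  have hT0 : 0 < b * κ + a * g := by nlinarith [mul_pos hb0 hk0, mul_pos ha0 hg0]
  have hsT : b * κ + a * g < a + b := by nlinarith [mul_pos hb0 (sub_pos.2 (hkx.trans hx1)), mul_nonneg ha0.le (sub_nonneg.2 hg1)]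
  have hDL : 0 < (1 - x) * b + (1 + x) * a - (b * κ + a * g) := by nlinarith [mul_pos hx0 (sub_pos.2 hab)]
  have key := BandTwoBlobCert.poly_C2L x κ g a b (by linarith) (by linarith) (by linarith) (by linarith) (by linarith) (by linarith) (by linarith) (by linarith) (by linarith) (by linarith) (by linarith) (by linarith) (by linarith) (by linarith) (by linarith) (by linarith) (by linarith) (by linarith) (by linarith) (by linarith)
  have e : ((x ^ 2 + (1 - x) * κ) * g - x / (1 - x) * ((1 - (x ^ 2 + (1 - x) * κ)) * (1 - g)
      - ((1 - (x ^ 2 + (1 - x) * κ)) * g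
          - (x ^ 2 * (a - b) + (1 - x) * (b * κ + a * g - 2 * b)) / ((1 - x) * ((1 - x) * b + (1 + x) * a - (b * κ + a * g)))
            * ((x ^ 2 + (1 - x) * κ) * (1 - g))) * (a - (b * κ + a * g)) / (b * κ + a * g)))
        * ((1 - x) ^ 2 * (b * κ + a * g) * ((1 - x) * b + (1 + x) * a - (b * κ + a * g)))
      = 2 * x^5 * g * a^2 - 2 * x^5 * g * a * b - x^5 * a^2 + x^5 * a * b - 2 * x^4 * κ * g * a^2 - x^4 * κ * g * a * b + x^4 * κ * g * b^2 + x^4 * κ * a^2 - 3 * x^4 * g^2 * a^2 + x^4 * g^2 * a * b + x^4 * g * a^2 + 4 * x^4 * g * a * b - 2 * x^4 * a * b + 3 * x^3 * κ^2 * g * a * b - x^3 * κ^2 * a * b + 3 * x^3 * κ * g^2 * a^2 + x^3 * κ * g^2 * a * b + x^3 * κ * g * a^2 - 5 * x^3 * κ * g * a * b - x^3 * κ * g * b^2 - x^3 * κ * a^2 + 4 * x^3 * κ * a * b - 2 * x^3 * κ * b^2 + x^3 * g^3 * a^2 + x^3 * g^2 * a^2 - x^3 * g^2 * a * b - x^3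 * g * a^2 - 4 * x^3 * g * a * b + 2 * x^3 * a * b - x^2 * κ^3 * g * b^2 - 2 * x^2 * κ^2 * g^2 * a * b - 4 * x^2 * κ^2 * g * a * b + x^2 * κ^2 * g * b^2 + x^2 * κ^2 * a * b - x^2 * κ * g^3 * a^2 - 4 * x^2 * κ * g^2 * a^2 + 2 * x^2 * κ * g * a^2 + 8 * x^2 * κ * g * a * b + x^2 * κ * g * b^2 - 4 * x^2 * κ * a * b + 2 * x^2 * κ * b^2 - x^2 * g^3 * a^2 + x^2 * g^2 * a^2 + x^2 * g^2 * a * b + 2 * x * κ^3 * g * b^2 + 4 * x * κ^2 * g^2 * a * b - 2 * x * κ^2 * g * b^2 + 2 * x * κ * g^3 * a^2 - 2 * x * κ * g^2 * a * b - x * κ * g * a^2 - 3 * x * κ * g * a * b + x * κ * a * b - x * κ * b^2 - κ^3 * g * b^2 - 2 * κ^2 * g^2 * a * b + κ^2 * g * a * b + κ^2 * g * b^2 - κ * g^3 * a^2 + κ * g^2 * a^2 + κ * g^2 * a * b := by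
    set T := b * κ + a * g with hT
    set D := (1 - x) * b + (1 + x) * a - T with hD'
    have hT0' : T ≠ 0 := hT0.ne'
    have hD0 : D ≠ 0 := hDL.ne'
    have h1x' : 1 - x ≠ 0 := h1x.ne'
    field_simp
    simp only [hD', hT]
    ring
  have hD : 0 < (1 - x) ^ 2 * (b * κ + a * g) * ((1 - x) * b + (1 + x) * a - (b * κ + a * g)) :=
    mul_pos (mul_pos (pow_pos h1x 2) hT0) hDL
  have h := (mul_nonneg_iff_of_pos_right hD).1 (by rw [e]; exact key)
  linarith

set_option maxHeartbeats 4000000 in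
set_option maxRecDepth 100000 in
/-- **cell C2H** (`T < a`, pair `(b,a)` heavy; `b` fits, atom `0` ships `(m_a − u₁m_b)/u₂` to the mid). [this work] -/
theorem giant_C2H (hx0 : 0 < x) (hx1 : x < 1) (hk0 : 0 < κ) (hkx : κ < x) (hxg : x ≤ g) (_hg1 : g ≤ 1) (hb0 : 0 < b) (hab : b < a)
    (hband : 2 * b ≤ b * κ + a * g) (hTa : b * κ + a * g < a) (_hH : x * (a - b) ≤ b * κ + a * g - 2 * b) :
    x / (1 - x) * ((1 - (x ^ 2 + (1 - x) * κ)) * (1 - g)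
      - ((1 - (x ^ 2 + (1 - x) * κ)) * g
          - (b * κ + a * g - 2 * b) / (b + a - (b * κ + a * g)) * ((x ^ 2 + (1 - x) * κ) * (1 - g)))
            * (a - (b * κ + a * g)) / (b * κ + a * g))
      ≤ (x ^ 2 + (1 - x) * κ) * g := by
  have h1x : 0 < 1 - x := sub_pos.2 hx1
  have ha0 : 0 < a := hb0.trans hab
  have hg0 : 0 < g := hx0.trans_le hxg
  have hgam : 0 < x ^ 2 + (1 - x) * κ := by nlinarith [mul_pos h1x hk0, pow_pos hx0 2]
  have hT0 : 0 < b * κ + a * g := by nlinarith [mul_pos hb0 hk0, mul_pos ha0 hg0]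
  have key := BandTwoBlobCert.poly_C2H x κ g a b (by linarith) (by linarith) (by linarith) (by linarith) (by linarith) (by linarith) (by linarith) (by linarith) (by linarith) (by linarith) (by linarith) (by linarith)
  have e : ((x ^ 2 + (1 - x) * κ) * g - x / (1 - x) * ((1 - (x ^ 2 + (1 - x) * κ)) * (1 - g)
      - ((1 - (x ^ 2 + (1 - x) * κ)) * g
          - (b * κ + a * g - 2 * b) / (b + a - (b * κ + a * g)) * ((x ^ 2 + (1 - x) * κ) * (1 - g)))
            * (a - (b * κ + a * g)) / (b * κ + a * g)))
        * ((1 - x) * (b * κ + a * g) * (a + b - (b * κ + a * g)))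
      = x^3 * κ * g * a * b + x^3 * κ * g * b^2 - x^3 * κ * b^2 + x^3 * g^2 * a^2 + x^3 * g^2 * a * b - x^3 * g * a^2 - 4 * x^3 * g * a * b + 2 * x^3 * a * b - x^2 * κ^2 * g * a * b - 2 * x^2 * κ^2 * g * b^2 + x^2 * κ^2 * b^2 - x^2 * κ * g^2 * a^2 - 3 * x^2 * κ * g^2 * a * b + x^2 * κ * g * a^2 + 5 * x^2 * κ * g * a * b + x^2 * κ * g * b^2 - 2 * x^2 * κ * a * b - x^2 * g^3 * a^2 + x^2 * g^2 * a^2 + x^2 * g^2 * a * b + x * κ^3 * g * b^2 + 2 * x * κ^2 * g^2 * a * b + x * κ * g^3 * a^2 - x * κ * g * a^2 - 3 * x * κ * g * a * b + x * κ * a * b - x * κ * b^2 - κ^3 * g * b^2 - 2 * κ^2 * g^2 * a * b + κ^2 * g * a * b + κ^2 * g * b^2 - κ * g^3 * a^2 + κ * g^2 * a^2 + κ * g^2 * a * b := by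
    set T := b * κ + a * g with hT
    set E := b + a - T with hE
    have hT0' : T ≠ 0 := hT0.ne'
    have hE0 : E ≠ 0 := by apply ne_of_gt; rw [hE]; linarith
    have h1x' : 1 - x ≠ 0 := h1x.ne'
    have hE' : a + b - T = E := by rw [hE]; ring
    rw [hE']
    field_simp
    simp only [hE, hT]
    ring
  have hD : 0 < (1 - x) * (b * κ + a * g) * (a + b - (b * κ + a * g)) := mul_pos (mul_pos h1x hT0) (by linarith)
  have h := (mul_nonneg_iff_of_pos_right hD).1 (by rw [e]; exact key)
  linarith

set_option maxHeartbeats 4000000 in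
set_option maxRecDepth 100000 in
/-- **cell C3L** (pair `(b,a)` light; `b` saturates the mid): `x/(1−x)·(m_b − m_a/u₁ + m₀) ≤ m_s`. [this work] -/
theorem giant_C3L (hx0 : 0 < x) (hx1 : x < 1) (hk0 : 0 < κ) (hkx : κ < x) (hxg : x ≤ g) (hg1 : g ≤ 1) (hb0 : 0 < b) (hab : b < a)
    (hband : 2 * b ≤ b * κ + a * g) (hL : b * κ + a * g - 2 * b ≤ x * (a - b)) :
    x / (1 - x) * ((x ^ 2 + (1 - x) * κ) * (1 - g)
      - (1 - (x ^ 2 + (1 - x) * κ)) * g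
          / ((x ^ 2 * (a - b) + (1 - x) * (b * κ + a * g - 2 * b)) / ((1 - x) * ((1 - x) * b + (1 + x) * a - (b * κ + a * g))))
      + (1 - (x ^ 2 + (1 - x) * κ)) * (1 - g))
      ≤ (x ^ 2 + (1 - x) * κ) * g := by
  have h1x : 0 < 1 - x := sub_pos.2 hx1
  have ha0 : 0 < a := hb0.trans hab
  have hg0 : 0 < g := hx0.trans_le hxg
  have hT0 : 0 < b * κ + a * g := by nlinarith [mul_pos hb0 hk0, mul_pos ha0 hg0]
  have hsT : b * κ + a * g < a + b := by nlinarith [mul_pos hb0 (sub_pos.2 (hkx.trans hx1)), mul_nonneg ha0.le (sub_nonneg.2 hg1)]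
  have hDL : 0 < (1 - x) * b + (1 + x) * a - (b * κ + a * g) := by nlinarith [mul_pos hx0 (sub_pos.2 hab)]
  have hN1 : 0 < x ^ 2 * (a - b) + (1 - x) * (b * κ + a * g - 2 * b) := by
    nlinarith [mul_pos (pow_pos hx0 2) (sub_pos.2 hab), mul_nonneg h1x.le (sub_nonneg.2 hband)]
  have key := BandTwoBlobCert.poly_C3L x κ g a b (by linarith) (by linarith) (by linarith) (by linarith) (by linarith) (by linarith) (by linarith) (by linarith) (by linarith)
  have e : ((x ^ 2 + (1 - x) * κ) * g - x / (1 - x) * ((x ^ 2 + (1 - x) * κ) * (1 - g)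
      - (1 - (x ^ 2 + (1 - x) * κ)) * g
          / ((x ^ 2 * (a - b) + (1 - x) * (b * κ + a * g - 2 * b)) / ((1 - x) * ((1 - x) * b + (1 + x) * a - (b * κ + a * g))))
      + (1 - (x ^ 2 + (1 - x) * κ)) * (1 - g)))
        * ((1 - x) * (x ^ 2 * (a - b) + (1 - x) * (b * κ + a * g - 2 * b)))
      = x^4 * g * a - x^4 * g * b - x^3 * κ * g * a - x^3 * g^2 * a - x^3 * g * a + 3 * x^3 * g * b - x^3 * a + x^3 * b + x^2 * κ^2 * g * b + x^2 * κ * g^2 * a + 2 * x^2 * κ * g * a - 3 * x^2 * κ * g * b + x^2 * κ * b + x^2 * g^2 * a + x^2 * g * a - 2 * x^2 * g * b - 2 * x^2 * b - 2 * x * κ^2 * g * b - 2 * x * κ * g^2 * a - x * κ * g * a + 5 * x * κ * g * b - x * κ * b - x * g * b + 2 * x * b + κ^2 * g * b + κ * g^2 * a - 2 * κ * g * b := by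
    set T := b * κ + a * g with hT
    set D := (1 - x) * b + (1 + x) * a - T with hD'
    set N := x ^ 2 * (a - b) + (1 - x) * (T - 2 * b) with hN
    have hN0 : N ≠ 0 := hN1.ne'
    have hD0 : D ≠ 0 := hDL.ne'
    have h1x' : 1 - x ≠ 0 := h1x.ne'
    field_simp
    simp only [hN, hD', hT]
    ring
  have hD : 0 < (1 - x) * (x ^ 2 * (a - b) + (1 - x) * (b * κ + a * g - 2 * b)) := mul_pos h1x hN1
  have h := (mul_nonneg_iff_of_pos_right hD).1 (by rw [e]; exact key)
  linarith

set_option maxHeartbeats 4000000 in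
set_option maxRecDepth 100000 in
/-- **cell C3H** (pair `(b,a)` heavy, `2b < T`; `b` saturates the mid): `x/(1−x)·(m_b − m_a/u₁ + m₀) ≤ m_s`. [this work] -/
theorem giant_C3H (hx0 : 0 < x) (hx1 : x < 1) (hk0 : 0 < κ) (hkx : κ < x) (hxg : x ≤ g) (hg1 : g ≤ 1) (hb0 : 0 < b) (hab : b < a)
    (hlow : 2 * b < b * κ + a * g) (hH : x * (a - b) ≤ b * κ + a * g - 2 * b) :
    x / (1 - x) * ((x ^ 2 + (1 - x) * κ) * (1 - g)
      - (1 - (x ^ 2 + (1 - x) * κ)) * g / ((b * κ + a * g - 2 * b) / (b + a - (b * κ + a * g)))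
      + (1 - (x ^ 2 + (1 - x) * κ)) * (1 - g))
      ≤ (x ^ 2 + (1 - x) * κ) * g := by
  have h1x : 0 < 1 - x := sub_pos.2 hx1
  have ha0 : 0 < a := hb0.trans hab
  have hg0 : 0 < g := hx0.trans_le hxg
  have hgam : 0 < x ^ 2 + (1 - x) * κ := by nlinarith [mul_pos h1x hk0, pow_pos hx0 2]
  have hT0 : 0 < b * κ + a * g := by nlinarith [mul_pos hb0 hk0, mul_pos ha0 hg0]
  have hsT : b * κ + a * g < a + b := by nlinarith [mul_pos hb0 (sub_pos.2 (hkx.trans hx1)), mul_nonneg ha0.le (sub_nonneg.2 hg1)]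
  have key := BandTwoBlobCert.poly_C3H x κ g a b (by linarith) (by linarith) (by linarith) (by linarith) (by linarith) (by linarith) (by linarith) (by linarith) (by linarith) (by linarith) (by linarith) (by linarith)
  have e : ((x ^ 2 + (1 - x) * κ) * g - x / (1 - x) * ((x ^ 2 + (1 - x) * κ) * (1 - g)
      - (1 - (x ^ 2 + (1 - x) * κ)) * g / ((b * κ + a * g - 2 * b) / (b + a - (b * κ + a * g)))
      + (1 - (x ^ 2 + (1 - x) * κ)) * (1 - g)))
        * ((1 - x) * (b * κ + a * g - 2 * b))
      = -x^3 * g * a + x^3 * g * b + x^2 * κ * g * a + x^2 * g^2 * a - 2 * x^2 * g * b - x * κ^2 * g * b - x * κ * g^2 * a - x * κ * g * a + 3 * x * κ * g * b - x * κ * b - x * g * b + 2 * x * b + κ^2 * g * b + κ * g^2 * a - 2 * κ * g * b := by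
    set T := b * κ + a * g with hT
    set E := b + a - T with hE
    set P := T - 2 * b with hP
    have hP0 : P ≠ 0 := by apply ne_of_gt; rw [hP]; linarith
    have hE0 : E ≠ 0 := by apply ne_of_gt; rw [hE]; linarith
    have h1x' : 1 - x ≠ 0 := h1x.ne'
    field_simp
    simp only [hP, hE, hT]
    ring
  have hD : 0 < (1 - x) * (b * κ + a * g - 2 * b) := mul_pos h1x (by linarith)
  have h := (mul_nonneg_iff_of_pos_right hD).1 (by rw [e]; exact key)
  linarith

/-! ### The numerics of the corner strategy -/

/-- **the corner strategy as numbers, pair `(b,a)` light.**  There are `F₁ ∈ [0, m_b]`, `F₂ ∈ [0, m₀]` (`F₂ > 0` only if `T < a`) loading the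
mid by `u₁F₁ + u₂F₂ ≤ m_a` and the giant by `x/(1−x)·((m_b − F₁) + (m₀ − F₂)) ≤ m_s`. [this work] -/
theorem band_numerics_L (hx0 : 0 < x) (hx1 : x < 1) (hk0 : 0 < κ) (hkx : κ < x) (hxg : x ≤ g) (hg1 : g ≤ 1) (hb0 : 0 < b) (hab : b < a)
    (hband : 2 * b ≤ b * κ + a * g) (hL : b * κ + a * g - 2 * b ≤ x * (a - b)) :
    ∃ F₁ F₂ : ℝ, 0 ≤ F₁ ∧ F₁ ≤ (x ^ 2 + (1 - x) * κ) * (1 - g) ∧ 0 ≤ F₂ ∧ F₂ ≤ (1 - (x ^ 2 + (1 - x) * κ)) * (1 - g) ∧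
      (0 < F₂ → b * κ + a * g < a) ∧
      (x ^ 2 * (a - b) + (1 - x) * (b * κ + a * g - 2 * b)) / ((1 - x) * ((1 - x) * b + (1 + x) * a - (b * κ + a * g))) * F₁
        + (b * κ + a * g) / (a - (b * κ + a * g)) * F₂ ≤ (1 - (x ^ 2 + (1 - x) * κ)) * g ∧
      x / (1 - x) * (((x ^ 2 + (1 - x) * κ) * (1 - g) - F₁) + ((1 - (x ^ 2 + (1 - x) * κ)) * (1 - g) - F₂))
        ≤ (x ^ 2 + (1 - x) * κ) * g := by
  have h1x : 0 < 1 - x := sub_pos.2 hx1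
  have ha0 : 0 < a := hb0.trans hab
  have hg0 : 0 < g := hx0.trans_le hxg
  have hgam : 0 < x ^ 2 + (1 - x) * κ := by nlinarith [mul_pos h1x hk0, pow_pos hx0 2]
  have hgam1 : x ^ 2 + (1 - x) * κ < 1 := by nlinarith [mul_lt_mul_of_pos_left hkx h1x]
  have hT0 : 0 < b * κ + a * g := by nlinarith [mul_pos hb0 hk0, mul_pos ha0 hg0]
  have hsT : b * κ + a * g < a + b := by nlinarith [mul_pos hb0 (sub_pos.2 (hkx.trans hx1)), mul_nonneg ha0.le (sub_nonneg.2 hg1)]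
  have hDL : 0 < (1 - x) * b + (1 + x) * a - (b * κ + a * g) := by nlinarith [mul_pos hx0 (sub_pos.2 hab)]
  have hxx : 0 < x / (1 - x) := div_pos hx0 h1x
  set γ' := x ^ 2 + (1 - x) * κ with hγ'
  set T := b * κ + a * g with hT
  set U := (x ^ 2 * (a - b) + (1 - x) * (T - 2 * b)) / ((1 - x) * ((1 - x) * b + (1 + x) * a - T)) with hU
  have hU0 : 0 ≤ U := div_nonneg (by nlinarith [mul_pos (pow_pos hx0 2) (sub_pos.2 hab)]) (mul_pos h1x hDL).le
  have hm0 : 0 ≤ (1 - γ') * (1 - g) := mul_nonneg (by linarith) (by linarith)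
  have hmb : 0 ≤ γ' * (1 - g) := mul_nonneg hgam.le (by linarith)
  have hma : 0 ≤ (1 - γ') * g := mul_nonneg (by linarith) hg0.le
  by_cases hcap : U * (γ' * (1 - g)) ≤ (1 - γ') * g
  · -- `b` fits into the mid
    by_cases hTa : a ≤ T
    · -- atom `0` cannot use the mid
      refine ⟨γ' * (1 - g), 0, hmb, le_rfl, le_rfl, hm0, fun h => absurd h (lt_irrefl 0), by rw [mul_zero, add_zero]; exact hcap, ?_⟩
      have h1 := giant_C1 x κ g a b hx0 hx1 hk0 hkx hxg hg1 hb0 hband hTa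
      rw [sub_self, zero_add, sub_zero]; exact h1
    · push Not at hTa
      have haT : 0 < a - T := sub_pos.2 hTa
      set F := ((1 - γ') * g - U * (γ' * (1 - g))) * (a - T) / T with hF
      have hF0 : 0 ≤ F := div_nonneg (mul_nonneg (sub_nonneg.2 hcap) haT.le) hT0.le
      have hFmid : T / (a - T) * F = (1 - γ') * g - U * (γ' * (1 - g)) := by
        rw [hF]; field_simp
      by_cases hfit : (1 - γ') * (1 - g) ≤ F
      · -- everything fits into the mid: the giant carries nothing
        refine ⟨γ' * (1 - g), (1 - γ') * (1 - g), hmb, le_rfl, hm0, le_rfl, fun _ => hTa, ?_, ?_⟩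
        · have hmono : T / (a - T) * ((1 - γ') * (1 - g)) ≤ T / (a - T) * F :=
            mul_le_mul_of_nonneg_left hfit (div_pos hT0 haT).le
          linarith [hmono, hFmid]
        · rw [sub_self, sub_self, add_zero, mul_zero]; exact mul_nonneg hgam.le hg0.le
      · push Not at hfit
        refine ⟨γ' * (1 - g), F, hmb, le_rfl, hF0, hfit.le, fun _ => hTa, by linarith [hFmid], ?_⟩
        have h2 := giant_C2L x κ g a b hx0 hx1 hk0 hkx hxg hg1 hb0 hab hband hTa hL
        rw [sub_self, zero_add, hF]
        exact h2
  · -- `b` saturates the mid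
    push Not at hcap
    have hUpos : 0 < U := by
      by_contra hn
      have hU0' : U = 0 := le_antisymm (not_lt.1 hn) hU0
      rw [hU0', zero_mul] at hcap
      exact absurd hcap (not_lt.2 hma)
    refine ⟨(1 - γ') * g / U, 0, div_nonneg hma hUpos.le, ?_, le_rfl, hm0, fun h => absurd h (lt_irrefl 0), ?_, ?_⟩
    · rw [div_le_iff₀ hUpos]; linarith
    · rw [mul_zero, add_zero, mul_div_cancel₀ _ hUpos.ne']
    · have h3 := giant_C3L x κ g a b hx0 hx1 hk0 hkx hxg hg1 hb0 hab hband hL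
      have e3 : (γ' * (1 - g) - (1 - γ') * g / U) + ((1 - γ') * (1 - g) - 0)
          = γ' * (1 - g) - (1 - γ') * g / U + (1 - γ') * (1 - g) := by ring
      rw [e3]
      exact h3

/-- **the corner strategy as numbers, pair `(b,a)` heavy.** [this work] -/
theorem band_numerics_H (hx0 : 0 < x) (hx1 : x < 1) (hk0 : 0 < κ) (hkx : κ < x) (hxg : x ≤ g) (hg1 : g ≤ 1) (hb0 : 0 < b) (hab : b < a)
    (hband : 2 * b ≤ b * κ + a * g) (hH : x * (a - b) ≤ b * κ + a * g - 2 * b) :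
    ∃ F₁ F₂ : ℝ, 0 ≤ F₁ ∧ F₁ ≤ (x ^ 2 + (1 - x) * κ) * (1 - g) ∧ 0 ≤ F₂ ∧ F₂ ≤ (1 - (x ^ 2 + (1 - x) * κ)) * (1 - g) ∧
      (0 < F₂ → b * κ + a * g < a) ∧
      (b * κ + a * g - 2 * b) / (b + a - (b * κ + a * g)) * F₁
        + (b * κ + a * g) / (a - (b * κ + a * g)) * F₂ ≤ (1 - (x ^ 2 + (1 - x) * κ)) * g ∧
      x / (1 - x) * (((x ^ 2 + (1 - x) * κ) * (1 - g) - F₁) + ((1 - (x ^ 2 + (1 - x) * κ)) * (1 - g) - F₂))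
        ≤ (x ^ 2 + (1 - x) * κ) * g := by
  have h1x : 0 < 1 - x := sub_pos.2 hx1
  have ha0 : 0 < a := hb0.trans hab
  have hg0 : 0 < g := hx0.trans_le hxg
  have hgam : 0 < x ^ 2 + (1 - x) * κ := by nlinarith [mul_pos h1x hk0, pow_pos hx0 2]
  have hgam1 : x ^ 2 + (1 - x) * κ < 1 := by nlinarith [mul_lt_mul_of_pos_left hkx h1x]
  have hT0 : 0 < b * κ + a * g := by nlinarith [mul_pos hb0 hk0, mul_pos ha0 hg0]
  have hsT : b * κ + a * g < a + b := by nlinarith [mul_pos hb0 (sub_pos.2 (hkx.trans hx1)), mul_nonneg ha0.le (sub_nonneg.2 hg1)]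
  have hxx : 0 < x / (1 - x) := div_pos hx0 h1x
  set γ' := x ^ 2 + (1 - x) * κ with hγ'
  set T := b * κ + a * g with hT
  set U := (T - 2 * b) / (b + a - T) with hU
  have hU0 : 0 ≤ U := div_nonneg (by linarith) (by linarith)
  have hm0 : 0 ≤ (1 - γ') * (1 - g) := mul_nonneg (by linarith) (by linarith)
  have hmb : 0 ≤ γ' * (1 - g) := mul_nonneg hgam.le (by linarith)
  have hma : 0 ≤ (1 - γ') * g := mul_nonneg (by linarith) hg0.le
  by_cases hcap : U * (γ' * (1 - g)) ≤ (1 - γ') * g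
  · -- `b` fits into the mid
    by_cases hTa : a ≤ T
    · refine ⟨γ' * (1 - g), 0, hmb, le_rfl, le_rfl, hm0, fun h => absurd h (lt_irrefl 0), by rw [mul_zero, add_zero]; exact hcap, ?_⟩
      have h1 := giant_C1 x κ g a b hx0 hx1 hk0 hkx hxg hg1 hb0 hband hTa
      rw [sub_self, zero_add, sub_zero]; exact h1
    · push Not at hTa
      have haT : 0 < a - T := sub_pos.2 hTa
      set F := ((1 - γ') * g - U * (γ' * (1 - g))) * (a - T) / T with hF
      have hF0 : 0 ≤ F := div_nonneg (mul_nonneg (sub_nonneg.2 hcap) haT.le) hT0.le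
      have hFmid : T / (a - T) * F = (1 - γ') * g - U * (γ' * (1 - g)) := by
        rw [hF]; field_simp
      by_cases hfit : (1 - γ') * (1 - g) ≤ F
      · refine ⟨γ' * (1 - g), (1 - γ') * (1 - g), hmb, le_rfl, hm0, le_rfl, fun _ => hTa, ?_, ?_⟩
        · have hmono : T / (a - T) * ((1 - γ') * (1 - g)) ≤ T / (a - T) * F :=
            mul_le_mul_of_nonneg_left hfit (div_pos hT0 haT).le
          linarith [hmono, hFmid]
        · rw [sub_self, sub_self, add_zero, mul_zero]; exact mul_nonneg hgam.le hg0.le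
      · push Not at hfit
        refine ⟨γ' * (1 - g), F, hmb, le_rfl, hF0, hfit.le, fun _ => hTa, by linarith [hFmid], ?_⟩
        have h2 := giant_C2H x κ g a b hx0 hx1 hk0 hkx hxg hg1 hb0 hab hband hTa hH
        rw [sub_self, zero_add, hF]
        exact h2
  · -- `b` saturates the mid (then `2b < T`, the rate being positive)
    push Not at hcap
    have hUpos : 0 < U := by
      by_contra hn
      have hU0' : U = 0 := le_antisymm (not_lt.1 hn) hU0
      rw [hU0', zero_mul] at hcap
      exact absurd hcap (not_lt.2 hma)
    have hlow : 2 * b < T := by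
      by_contra hn
      have hz : T - 2 * b = 0 := by linarith [not_lt.1 hn]
      rw [hU, hz, zero_div] at hUpos
      exact lt_irrefl _ hUpos
    refine ⟨(1 - γ') * g / U, 0, div_nonneg hma hUpos.le, ?_, le_rfl, hm0, fun h => absurd h (lt_irrefl 0), ?_, ?_⟩
    · rw [div_le_iff₀ hUpos]; linarith
    · rw [mul_zero, add_zero, mul_div_cancel₀ _ hUpos.ne']
    · have h3 := giant_C3H x κ g a b hx0 hx1 hk0 hkx hxg hg1 hb0 hab hlow hH
      have e3 : (γ' * (1 - g) - (1 - γ') * g / U) + ((1 - γ') * (1 - g) - 0)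
          = γ' * (1 - g) - (1 - γ') * g / U + (1 - γ') * (1 - g) := by ring
      rw [e3]
      exact h3

end Cells

end LawDec

end Quant

end Summit.CriticalPhenomena.PercolationContinuityZ3.Theorems
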